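import Literature.NumberTheory.LFunctions.NoRealZeroSmallModuliII
import Literature.Barriers.RiemannHypothesis.FeketePolyaPositivityLaplaceProofs
import Literature.Barriers.RiemannHypothesis.FeketePolyaPositivitySplitPrimes
import HarnessLib

/-!
# Fekete–Pólya positivity from a finite value table at EVERY order `k`, and along induced
# characters: `L(σ, χ) > 0` on `σ > 0` by one kernel computation over one period

Topic `Literature/NumberTheory/LFunctions`; namespace `Literature.NumberTheory.LFunctions.FeketePolyaTable`
(extends the order-one/two engine `FeketePolyaTables.lean`). Small computable definitions (`ipsum`,
`cumsumAux`, `iterCumsum`, `valList`, `iterCheck`, `inducedCheck`) and THEOREMS — no named fact, no `sorry`.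

Fekete–Pólya (MV §11.2.1 Exercise 7 (g); PROVED in the tree for every order as
`Literature.Barriers.RiemannHypothesis.FeketePolya1912_holds`): if `χ ≠ χ₀` is quadratic mod `q` and for
some `k ≥ 1` the `k`-th iterated sum `S_k(N, χ) ≥ 0` for all `N ≥ 1`, then `L(σ, χ) > 0` for every `σ > 0`.
Chowla's refinement (Exercise 8; tree `re_LFunction_pos_of_induced_*`): it suffices that some INDUCED
character `χ↑m` (`q ∣ m`) has this property, since `L(σ, χ↑m) = L(σ, χ)·∏_{p ∣ m}(1 − χ(p)p^{−σ})` with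
positive Euler factors. Both hypotheses quantify over ALL `N`; this file reduces them to ONE period:

* `ipsum l k N = S_k(N)` of the periodic integer table `l` (`S_0 = tableVal l`,
  `S_{k+1}(N) = ∑_{n=1}^{N} S_k(n)`), `ipsum_cast` (= the tree's `iterSummatory` of `n ↦ tableVal l n`);
* **one period suffices at every order** (`ipsum_nonneg_of_period`): if `m = |l| > 0`,
  `S_j(m) ≥ 0` for `1 ≤ j ≤ k` and `S_k(N) ≥ 0` for `1 ≤ N ≤ m`, then `S_k(N) ≥ 0` for all `N ≥ 1`
  (the differences `S_k(N + m) − S_k(N)` are `≥ 0`: they vanish at order `0` by periodicity and satisfy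
  `Δ_{k+1}(N) = S_{k+1}(m) + ∑_{i ≤ N} Δ_k(i)`);
* the kernel check `iterCheck l k` (iterated prefix sums of the list of values over one period, all
  orders computed in `O(k·m)` integer additions) and its soundness `ipsum_nonneg_of_iterCheck`;
* **the engines** `lfunction_re_pos_of_table_iter` / `lfunction_ne_zero_of_table_iter` (character with
  tabulated values, any order) and `lfunction_re_pos_of_induced_table_iter` /
  `lfunction_ne_zero_of_induced_table_iter` (the table `L` of an induced character `χ↑m`, validated
  against the table `l` of `χ` by the kernel check `inducedCheck l L`: `L[n] = l[n]` if `gcd(n, m) = 1`,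
  else `0`);
* small helpers for range files: `odd_of_table` (parity from the table), and the moduli carrying no
  primitive quadratic character (`noPrimQuad_two_mul`, `noPrimQuad_of_sq`, `noPrimQuad_two_pow_mul_of_sq`,
  `noPrimQuad_two_pow_mul_of_four_le`).

Used by `NoRealZeroSmallModuliIII.lean` ff. (kernel base of the certified no-real-zero tables beyond
modulus `52`).

## References

* H. L. Montgomery, R. C. Vaughan, *Multiplicative Number Theory I*, CUP 2007, §11.2.1 Exercises 7–8.
  [MontgomeryVaughan2007]
* M. Fekete, G. Pólya, *Über ein Problem von Laguerre*, Rend. Circ. Mat. Palermo 34 (1912) 89–120.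
  [FeketePolya1912]
* S. Chowla, *Note on Dirichlet's `L`-functions*, Acta Arith. 1 (1935) 113–114. [Chowla1935]
* J. B. Rosser, *Real roots of real Dirichlet L-series*, J. Research Nat. Bur. Standards 45 (1950)
  505–514. [Rosser1950RealRoots]
-/

namespace Literature.NumberTheory.LFunctions

namespace FeketePolyaTable

open Finset Literature.Barriers.RiemannHypothesis Literature.NumberTheory.LFunctions.PrimitiveQuadratic

/-! ### Iterated running sums of a periodic table, all orders -/

/-- `ipsum l k = S_k`, the `k`-th iterated running sum of the periodic table `l`: `S_0 = tableVal l`,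
`S_{k+1}(N) = ∑_{n=1}^{N} S_k(n)`. [cite: MontgomeryVaughan2007, §11.2.1 Exercise 7 (c)] -/
def ipsum (l : List ℤ) : ℕ → ℕ → ℤ
  | 0 => tableVal l
  | k + 1 => fun N ↦ ∑ n ∈ Icc 1 N, ipsum l k n

variable (l : List ℤ)

/-- `S_0 = tableVal l`. [folklore] -/
@[simp] private theorem ipsum_zero (N : ℕ) : ipsum l 0 N = tableVal l N := rfl

/-- `S_{k+1}(N) = ∑_{n=1}^{N} S_k(n)`. [folklore] -/
private theorem ipsum_succ (k N : ℕ) : ipsum l (k + 1) N = ∑ n ∈ Icc 1 N, ipsum l k n := rfl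

/-- `S_{k+1}(0) = 0`. [folklore] -/
@[simp] private theorem ipsum_succ_zero (k : ℕ) : ipsum l (k + 1) 0 = 0 := by
  rw [ipsum_succ]; rfl

/-- `S_{k+1}(N+1) = S_{k+1}(N) + S_k(N+1)`. [folklore] -/
private theorem ipsum_succ_succ (k N : ℕ) : ipsum l (k + 1) (N + 1) = ipsum l (k + 1) N + ipsum l k (N + 1) := by
  rw [ipsum_succ, ipsum_succ, Finset.sum_Icc_succ_top (by omega)]

/-- `S_k` as the tree's `iterSummatory` of `n ↦ tableVal l n` (real-valued). [folklore] -/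
private theorem ipsum_cast (k N : ℕ) :
    (ipsum l k N : ℝ) = iterSummatory (fun n ↦ ((tableVal l n : ℤ) : ℝ)) k N := by
  induction k generalizing N with
  | zero => simp
  | succ k ih =>
    rw [ipsum_succ, iterSummatory_succ, summatory]
    push_cast
    exact Finset.sum_congr rfl fun n _ ↦ ih n

/-! ### One period suffices, at every order -/

/-- The table is `|l|`-periodic. [folklore] -/
private theorem tableVal_add_length' (n : ℕ) : tableVal l (n + l.length) = tableVal l n := by
  simp [tableVal]

/-- The period differences `Δ_k(N) = S_k(N + m) − S_k(N)` (`m = |l|`). [folklore] -/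
def pdiff (k N : ℕ) : ℤ := ipsum l k (N + l.length) - ipsum l k N

/-- `Δ_0 = 0` (periodicity of the table). [folklore] -/
private theorem pdiff_zero (N : ℕ) : pdiff l 0 N = 0 := by
  simp [pdiff, tableVal_add_length']

/-- `Δ_{k+1}(0) = S_{k+1}(m)`. [folklore] -/
private theorem pdiff_succ_zero (k : ℕ) : pdiff l (k + 1) 0 = ipsum l (k + 1) l.length := by
  simp [pdiff]

/-- `Δ_{k+1}(N+1) = Δ_{k+1}(N) + Δ_k(N+1)`. [folklore] -/
private theorem pdiff_succ_succ (k N : ℕ) : pdiff l (k + 1) (N + 1) = pdiff l (k + 1) N + pdiff l k (N + 1) := by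
  simp only [pdiff]
  rw [show N + 1 + l.length = (N + l.length) + 1 by omega, ipsum_succ_succ, ipsum_succ_succ]
  ring

/-- If `S_j(m) ≥ 0` for `1 ≤ j ≤ k` then `Δ_k(N) ≥ 0` for all `N`. [cite: MontgomeryVaughan2007, §11.2.1 Exercise 7 (f)] -/
theorem pdiff_nonneg {k : ℕ} (hS : ∀ j, 1 ≤ j → j ≤ k → 0 ≤ ipsum l j l.length) (N : ℕ) :
    0 ≤ pdiff l k N := by
  induction k generalizing N with
  | zero => rw [pdiff_zero]
  | succ k ih =>
    have ih' : ∀ N, 0 ≤ pdiff l k N := fun N ↦ ih (fun j hj hjk ↦ hS j hj (by omega)) N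
    induction N with
    | zero => rw [pdiff_succ_zero]; exact hS (k + 1) (by omega) le_rfl
    | succ N ihN => rw [pdiff_succ_succ]; exact add_nonneg ihN (ih' _)

/-- **One period suffices, every order.** If `m = |l| > 0`, `S_j(m) ≥ 0` for `1 ≤ j ≤ k`, and
`S_k(N) ≥ 0` for `1 ≤ N ≤ m`, then `S_k(N) ≥ 0` for every `N ≥ 1`. [cite: MontgomeryVaughan2007, §11.2.1 Exercise 7 (f)] -/
theorem ipsum_nonneg_of_period (hl : 0 < l.length) {k : ℕ}
    (hS : ∀ j, 1 ≤ j → j ≤ k → 0 ≤ ipsum l j l.length)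
    (hchk : ∀ N, 1 ≤ N → N ≤ l.length → 0 ≤ ipsum l k N) : ∀ N, 1 ≤ N → 0 ≤ ipsum l k N := by
  intro N
  induction N using Nat.strong_induction_on with
  | _ N ih =>
    intro hN
    by_cases hNm : N ≤ l.length
    · exact hchk N hN hNm
    · have hsplit : N = (N - l.length) + l.length := by omega
      have h1 : 1 ≤ N - l.length := by omega
      have hrec := ih (N - l.length) (by omega) h1
      have hd := pdiff_nonneg l hS (N - l.length)
      rw [pdiff, ← hsplit] at hd
      linarith

/-! ### The kernel check: iterated prefix sums of the list of values over one period -/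

/-- Prefix sums with an accumulator: `cumsumAux a [x₁, x₂, …] = [a + x₁, a + x₁ + x₂, …]`. [folklore] -/
def cumsumAux : ℤ → List ℤ → List ℤ
  | _, [] => []
  | a, x :: xs => (a + x) :: cumsumAux (a + x) xs

/-- `k`-fold prefix sums of a list. [folklore] -/
def iterCumsum : ℕ → List ℤ → List ℤ
  | 0, L => L
  | k + 1, L => cumsumAux 0 (iterCumsum k L)

/-- The values over one period: `valList l = [tableVal l 1, …, tableVal l m]`. [folklore] -/
def valList : List ℤ := (List.range l.length).map fun i ↦ tableVal l (i + 1)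

/-- **The kernel check at order `k`**: the last entries of the `j`-fold prefix sums (`S_j(m)`,
`1 ≤ j ≤ k`) are `≥ 0` and every entry of the `k`-fold prefix sums (`S_k(N)`, `1 ≤ N ≤ m`) is `≥ 0`.
[cite: MontgomeryVaughan2007, §11.2.1 Exercise 7 (f)] -/
def iterCheck (k : ℕ) : Bool :=
  ((List.range k).all fun j ↦ decide (0 ≤ (iterCumsum (j + 1) (valList l)).getD (l.length - 1) 0)) &&
    ((iterCumsum k (valList l)).all fun x ↦ decide (0 ≤ x))

/-- Length of `cumsumAux`. [folklore] -/
private theorem length_cumsumAux (a : ℤ) (L : List ℤ) : (cumsumAux a L).length = L.length := by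
  induction L generalizing a with
  | nil => rfl
  | cons x xs ih => simp [cumsumAux, ih]

/-- Length of `iterCumsum`. [folklore] -/
private theorem length_iterCumsum (k : ℕ) (L : List ℤ) : (iterCumsum k L).length = L.length := by
  induction k with
  | zero => rfl
  | succ k ih => rw [iterCumsum, length_cumsumAux, ih]

/-- Length of `valList`. [folklore] -/
private theorem length_valList : (valList l).length = l.length := by
  simp [valList]

/-- Entries of `cumsumAux`: `(cumsumAux a L)[i] = a + ∑_{j ≤ i} L[j]`. [folklore] -/
private theorem getD_cumsumAux (L : List ℤ) (a : ℤ) (i : ℕ) (hi : i < L.length) :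
    (cumsumAux a L).getD i 0 = a + ∑ j ∈ range (i + 1), L.getD j 0 := by
  induction L generalizing a i with
  | nil => simp at hi
  | cons x xs ih =>
    cases i with
    | zero => simp [cumsumAux]
    | succ i =>
      simp only [List.length_cons, Nat.succ_lt_succ_iff] at hi
      rw [cumsumAux, List.getD_cons_succ, ih (a + x) i hi, Finset.sum_range_succ' _ (i + 1)]
      simp only [List.getD_cons_succ, List.getD_cons_zero]
      ring

/-- Entries of `valList`. [folklore] -/
private theorem getD_valList (i : ℕ) (hi : i < l.length) : (valList l).getD i 0 = tableVal l (i + 1) := by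
  unfold valList
  rw [List.getD_eq_getElem?_getD, List.getElem?_map, List.getElem?_range hi]
  rfl

/-- `∑_{n=1}^{N} f(n) = ∑_{j<N} f(j+1)`. [folklore] -/
private theorem sum_Icc_one_eq_sum_range (f : ℕ → ℤ) (N : ℕ) :
    ∑ n ∈ Icc 1 N, f n = ∑ j ∈ range N, f (j + 1) := by
  induction N with
  | zero => rfl
  | succ N ih => rw [Finset.sum_Icc_succ_top (by omega), ih, Finset.sum_range_succ]

/-- **The check computes `S_k`**: `(iterCumsum k (valList l))[i] = S_k(i + 1)` for `i < m`. [folklore] -/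
private theorem getD_iterCumsum (k i : ℕ) (hi : i < l.length) :
    (iterCumsum k (valList l)).getD i 0 = ipsum l k (i + 1) := by
  induction k generalizing i with
  | zero => rw [iterCumsum, getD_valList l i hi, ipsum_zero]
  | succ k ih =>
    have hlen : i < (iterCumsum k (valList l)).length := by
      rw [length_iterCumsum, length_valList]; exact hi
    rw [iterCumsum, getD_cumsumAux _ 0 i hlen, zero_add, ipsum_succ, sum_Icc_one_eq_sum_range]
    refine Finset.sum_congr rfl fun j hj ↦ ih j ?_
    have := Finset.mem_range.mp hj
    omega

/-- **Soundness of the kernel check.** If `iterCheck l k = true` and `m = |l| > 0`, then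
`S_j(m) ≥ 0` for `1 ≤ j ≤ k` and `S_k(N) ≥ 0` for `1 ≤ N ≤ m`; hence (`ipsum_nonneg_of_period`)
`S_k(N) ≥ 0` for every `N ≥ 1`. [cite: MontgomeryVaughan2007, §11.2.1 Exercise 7 (f)] -/
theorem ipsum_nonneg_of_iterCheck (hl : 0 < l.length) {k : ℕ} (h : iterCheck l k = true) :
    ∀ N, 1 ≤ N → 0 ≤ ipsum l k N := by
  rw [iterCheck, Bool.and_eq_true, List.all_eq_true, List.all_eq_true] at h
  obtain ⟨hlast, hall⟩ := h
  refine ipsum_nonneg_of_period l hl (fun j hj hjk ↦ ?_) (fun N hN hNm ↦ ?_)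
  · have hmem : j - 1 ∈ List.range k := List.mem_range.mpr (by omega)
    have h1 := of_decide_eq_true (hlast (j - 1) hmem)
    rw [show j - 1 + 1 = j by omega, getD_iterCumsum l j (l.length - 1) (by omega),
      show l.length - 1 + 1 = l.length by omega] at h1
    exact h1
  · have hlen : N - 1 < (iterCumsum k (valList l)).length := by
      rw [length_iterCumsum, length_valList]; omega
    have hmem : (iterCumsum k (valList l))[N - 1] ∈ iterCumsum k (valList l) := List.getElem_mem hlen
    have h1 := of_decide_eq_true (hall _ hmem)
    have h2 := getD_iterCumsum l k (N - 1) (by omega)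
    rw [List.getD_eq_getElem _ _ hlen, show N - 1 + 1 = N by omega] at h2
    rwa [h2] at h1

/-- `S_k(N, n ↦ tableVal l n) ≥ 0` for all `N ≥ 1`, in the tree's `iterSummatory` currency.
[cite: MontgomeryVaughan2007, §11.2.1 Exercise 7 (f)] -/
theorem iterSummatory_tableVal_nonneg (hl : 0 < l.length) {k : ℕ} (h : iterCheck l k = true) (N : ℕ)
    (hN : 1 ≤ N) : 0 ≤ iterSummatory (fun n ↦ ((tableVal l n : ℤ) : ℝ)) k N := by
  rw [← ipsum_cast]
  exact_mod_cast ipsum_nonneg_of_iterCheck l hl h N hN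

/-! ### The engines: a character with tabulated values, any order -/

variable {q : ℕ} (χ : DirichletCharacter ℂ q)

/-- **Order `k` from a table.** Let `χ ≠ χ₀` be quadratic mod `q` with `χ(n) = tableVal l n` for all
`n` (`|l| > 0`), `k ≥ 1`, and `iterCheck l k` (a finite kernel check). Then `ℜL(σ, χ) > 0` for every
`σ > 0` (Fekete–Pólya at order `k`, the tree's `FeketePolya1912_holds`).
[cite: MontgomeryVaughan2007, §11.2.1 Exercise 7 (g)] [cite: FeketePolya1912] -/
theorem lfunction_re_pos_of_table_iter [NeZero q] (hχ : χ ≠ 1) (hquad : χ.IsQuadratic)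
    (hl : 0 < l.length) (hv : ∀ n : ℕ, χ (n : ZMod q) = ((tableVal l n : ℤ) : ℂ)) {k : ℕ} (hk : 1 ≤ k)
    (h : iterCheck l k = true) {σ : ℝ} (hσ : 0 < σ) : 0 < (χ.LFunction (σ : ℂ)).re := by
  have hf : (fun n : ℕ ↦ (χ (n : ZMod q)).re) = fun n ↦ ((tableVal l n : ℤ) : ℝ) := by
    funext n; rw [hv n, Complex.intCast_re]
  refine FeketePolya1912_holds q χ hχ hquad k hk (fun N hN ↦ ?_) σ hσ
  rw [hf]
  exact iterSummatory_tableVal_nonneg l hl h N hN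

/-- Order `k`, non-vanishing form: `L(σ, χ) ≠ 0` for `σ > 0`. [cite: MontgomeryVaughan2007, §11.2.1 Exercise 7 (g)] -/
theorem lfunction_ne_zero_of_table_iter [NeZero q] (hχ : χ ≠ 1) (hquad : χ.IsQuadratic)
    (hl : 0 < l.length) (hv : ∀ n : ℕ, χ (n : ZMod q) = ((tableVal l n : ℤ) : ℂ)) {k : ℕ} (hk : 1 ≤ k)
    (h : iterCheck l k = true) {σ : ℝ} (hσ : 0 < σ) : χ.LFunction (σ : ℂ) ≠ 0 := by
  intro h0
  have := lfunction_re_pos_of_table_iter l χ hχ hquad hl hv hk h hσ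
  rw [h0, Complex.zero_re] at this
  exact lt_irrefl _ this

/-! ### The engines along an induced character (Chowla) -/

/-- **The induced-table check**: `L` is the value table of the character `χ↑m` induced by a character
`χ` with value table `l`, `m = |L|`: `L[n] = tableVal l n` if `gcd(n, m) = 1` and `L[n] = 0` otherwise,
for `n < m`. [cite: MontgomeryVaughan2007, §11.2.1 Exercise 8] -/
def inducedCheck (L : List ℤ) : Bool :=
  (List.range L.length).all fun n ↦
    decide (L.getD n 0 = if Nat.gcd n L.length = 1 then tableVal l n else 0)

/-- Values of the induced character from the check: for `q ∣ m = |L|` and `χ(n) = tableVal l n`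
(`|l| = q`), `ℜ(χ↑m)(n) = tableVal L n` for all `n`. [cite: MontgomeryVaughan2007, §11.2.1 Exercise 8] -/
theorem re_changeLevel_eq_tableVal [NeZero q] {m : ℕ} [NeZero m] (hqm : q ∣ m) (L : List ℤ)
    (hlq : l.length = q) (hLm : L.length = m) (hv : ∀ n : ℕ, χ (n : ZMod q) = ((tableVal l n : ℤ) : ℂ))
    (hind : inducedCheck l L = true) (n : ℕ) :
    (DirichletCharacter.changeLevel hqm χ (n : ZMod m)).re = ((tableVal L n : ℤ) : ℝ) := by
  rw [inducedCheck, List.all_eq_true] at hind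
  have hm0 : 0 < m := Nat.pos_of_ne_zero (NeZero.ne m)
  have hnm : n % m < m := Nat.mod_lt n hm0
  have hspec := of_decide_eq_true (hind (n % m) (List.mem_range.mpr (by rw [hLm]; exact hnm)))
  -- `tableVal L n = L[n mod m]`, `tableVal l (n mod m) = tableVal l n` (as `q ∣ m`), `gcd(n mod m, m) = gcd(n, m)`
  have hT : tableVal L n = L.getD (n % m) 0 := by rw [tableVal, hLm]
  have hl' : tableVal l (n % m) = tableVal l n := by
    unfold tableVal; rw [hlq, Nat.mod_mod_of_dvd n hqm]
  have hg : Nat.gcd (n % m) m = Nat.gcd n m := by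
    rw [← Nat.gcd_rec, Nat.gcd_comm]
  by_cases hc : n.Coprime m
  · have hc' : Nat.gcd (n % m) L.length = 1 := by
      rw [hLm, hg]; exact Nat.Coprime.gcd_eq_one hc
    rw [if_pos hc'] at hspec
    rw [re_changeLevel_apply_natCast χ hqm n, if_pos hc, hT, hspec, hl', hv n, Complex.intCast_re]
  · have hc' : ¬ Nat.gcd (n % m) L.length = 1 := by
      rw [hLm, hg]; exact fun h ↦ hc (Nat.coprime_iff_gcd_eq_one.mpr h)
    rw [if_neg hc'] at hspec
    rw [re_changeLevel_apply_natCast χ hqm n, if_neg hc, hT, hspec, Int.cast_zero]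

/-- **Order `k` along an induced character.** Let `χ ≠ χ₀` be quadratic mod `q` with value table `l`
(`χ(n) = tableVal l n`, `|l| = q`), `q ∣ m`, `L` a table of length `m` passing `inducedCheck l L` (so `L`
tabulates `χ↑m`), `k ≥ 1` and `iterCheck L k`. Then `ℜL(σ, χ) > 0` for every `σ > 0`: Fekete–Pólya at
order `k` gives `ℜL(σ, χ↑m) > 0`, and `L(σ, χ↑m) = L(σ, χ)·∏_{p ∣ m}(1 − χ(p)p^{−σ})` with a positive Euler
product (tree `re_LFunction_changeLevel_ofReal`, `eulerFactors_pos`).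
[cite: MontgomeryVaughan2007, §11.2.1 Exercise 8] [cite: Chowla1935] -/
theorem lfunction_re_pos_of_induced_table_iter [NeZero q] {m : ℕ} [NeZero m] (hχ : χ ≠ 1)
    (hquad : χ.IsQuadratic) (hqm : q ∣ m) (L : List ℤ) (hlq : l.length = q) (hLm : L.length = m)
    (hv : ∀ n : ℕ, χ (n : ZMod q) = ((tableVal l n : ℤ) : ℂ)) (hind : inducedCheck l L = true) {k : ℕ}
    (hk : 1 ≤ k) (h : iterCheck L k = true) {σ : ℝ} (hσ : 0 < σ) : 0 < (χ.LFunction (σ : ℂ)).re := by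
  set ψ := DirichletCharacter.changeLevel hqm χ with hψ
  have hψ1 : ψ ≠ 1 := fun h' ↦ hχ ((DirichletCharacter.changeLevel_eq_one_iff hqm).mp h')
  have hsq : χ ^ 2 = 1 := MulChar.isQuadratic_iff_sq_eq_one.mp hquad
  have hψsq : ψ ^ 2 = 1 := by rw [hψ, ← map_pow, hsq, map_one]
  have hψquad : ψ.IsQuadratic := MulChar.isQuadratic_iff_sq_eq_one.mpr hψsq
  have hLpos : 0 < L.length := by rw [hLm]; exact Nat.pos_of_ne_zero (NeZero.ne m)
  have hf : (fun n : ℕ ↦ (ψ (n : ZMod m)).re) = fun n ↦ ((tableVal L n : ℤ) : ℝ) := by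
    funext n; exact re_changeLevel_eq_tableVal l χ hqm L hlq hLm hv hind n
  have hψpos : 0 < (ψ.LFunction (σ : ℂ)).re := by
    refine FeketePolya1912_holds m ψ hψ1 hψquad k hk (fun N hN ↦ ?_) σ hσ
    rw [hf]
    exact iterSummatory_tableVal_nonneg L hLpos h N hN
  rw [hψ, re_LFunction_changeLevel_ofReal hqm χ hχ hsq σ] at hψpos
  exact pos_of_mul_pos_left hψpos (eulerFactors_pos m χ hsq hσ).le

/-- Order `k` along an induced character, non-vanishing form: `L(σ, χ) ≠ 0` for `σ > 0`.
[cite: MontgomeryVaughan2007, §11.2.1 Exercise 8] -/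
theorem lfunction_ne_zero_of_induced_table_iter [NeZero q] {m : ℕ} [NeZero m] (hχ : χ ≠ 1)
    (hquad : χ.IsQuadratic) (hqm : q ∣ m) (L : List ℤ) (hlq : l.length = q) (hLm : L.length = m)
    (hv : ∀ n : ℕ, χ (n : ZMod q) = ((tableVal l n : ℤ) : ℂ)) (hind : inducedCheck l L = true) {k : ℕ}
    (hk : 1 ≤ k) (h : iterCheck L k = true) {σ : ℝ} (hσ : 0 < σ) : χ.LFunction (σ : ℂ) ≠ 0 := by
  intro h0
  have := lfunction_re_pos_of_induced_table_iter l χ hχ hquad hqm L hlq hLm hv hind hk h hσ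
  rw [h0, Complex.zero_re] at this
  exact lt_irrefl _ this

/-! ### Helpers for range files -/

/-- **Parity from the table**: if `χ(n) = tableVal l n` for all `n` and `tableVal l (q − 1) = −1`
(`q ≥ 2`), then `χ` is odd (`χ(−1) = χ(q − 1) = −1`). [cite: MontgomeryVaughan2007, §9.1 (odd characters: `χ(−1) = −1`)] -/
theorem odd_of_table [NeZero q] (hq : 2 ≤ q) (hv : ∀ n : ℕ, χ (n : ZMod q) = ((tableVal l n : ℤ) : ℂ))
    (hlast : tableVal l (q - 1) = -1) : χ.Odd := by
  rw [DirichletCharacter.Odd]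
  have hcast : ((q - 1 : ℕ) : ZMod q) = -1 := by
    rw [Nat.cast_sub (by omega), ZMod.natCast_self, zero_sub, Nat.cast_one]
  rw [← hcast, hv (q - 1), hlast]
  push_cast
  ring

/-- Modulus `2m`, `m` odd: no primitive character at all. [cite: MontgomeryVaughan2007, Theorem 9.13] -/
theorem noPrimQuad_two_mul {m : ℕ} [NeZero m] (hm : Odd m) :
    ∀ χ : DirichletCharacter ℂ (2 ^ 1 * m), χ.IsQuadratic → χ.IsPrimitive →
      ∀ σ : ℝ, 0 < σ → σ < 1 → χ.LFunction σ ≠ 0 :=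
  fun _ _ hprim ↦ (not_isPrimitive_two_mul hm hprim).elim

/-- Odd modulus with a square factor `p²` (`p > 1`): no primitive quadratic character.
[cite: MontgomeryVaughan2007, Theorem 9.13] -/
theorem noPrimQuad_of_sq {q : ℕ} [NeZero q] (hodd : Odd q) {p : ℕ} (hp : 1 < p) (hpq : p * p ∣ q) :
    ∀ χ : DirichletCharacter ℂ q, χ.IsQuadratic → χ.IsPrimitive →
      ∀ σ : ℝ, 0 < σ → σ < 1 → χ.LFunction σ ≠ 0 := by
  intro χ hquad hprim
  have h := squarefree_of_isPrimitive_of_isQuadratic hodd hprim hquad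
  have hu := Nat.isUnit_iff.mp (h p hpq)
  omega

/-- Modulus `2^k · m` (`m` odd) with a square factor `p² ∣ m` (`p > 1`): no primitive quadratic
character. [cite: MontgomeryVaughan2007, Theorem 9.13] -/
theorem noPrimQuad_two_pow_mul_of_sq {k m : ℕ} [NeZero m] (hm : Odd m) {p : ℕ} (hp : 1 < p)
    (hpm : p * p ∣ m) :
    ∀ χ : DirichletCharacter ℂ (2 ^ k * m), χ.IsQuadratic → χ.IsPrimitive →
      ∀ σ : ℝ, 0 < σ → σ < 1 → χ.LFunction σ ≠ 0 := by
  intro χ hquad hprim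
  have h := squarefree_of_level_two_pow_mul hm hprim hquad
  have hu := Nat.isUnit_iff.mp (h p hpm)
  omega

/-- Modulus `2^k · m` (`m` odd) with `k ≥ 4`: no primitive quadratic character.
[cite: MontgomeryVaughan2007, Theorem 9.13] -/
theorem noPrimQuad_two_pow_mul_of_four_le {k m : ℕ} [NeZero m] (hm : Odd m) (hk : 4 ≤ k) :
    ∀ χ : DirichletCharacter ℂ (2 ^ k * m), χ.IsQuadratic → χ.IsPrimitive →
      ∀ σ : ℝ, 0 < σ → σ < 1 → χ.LFunction σ ≠ 0 := by
  intro χ hquad hprim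
  have := le_three_of_level_two_pow_mul hm hprim hquad
  omega

end FeketePolyaTable

end Literature.NumberTheory.LFunctions
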